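import Mathlib
import Summits.NavierStokesRegularity.NavierStokesRegularity.Theorems.EulerZoomLiouvillePowerGaugeEulerLiouvilleSelfSimilarPastStrata
import Summits.NavierStokesRegularity.NavierStokesRegularity.Theorems.EulerZoomLiouvillePowerGaugeEulerLiouvilleSelfSimilarPiercingSpheres
import HarnessLib

/-!
# PAST-EXACT self-similar members whose `C²` profile has IRROTATIONAL PIERCING (or BARRIER SPHERES) beyond every radius are trivial
# (crux `EulerZoomLiouville.PowerGaugeEulerLiouville` = stmt-NavierStokesRegularity-19832, line `birth`; the PAST/SHIFTED twin of
# `…SelfSimilarPiercingSpheres` / `…SelfSimilarSphereBarriers`)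

Route `EulerZoomLiouville` (NavierStokesRegularity).  Width seat ns-ezl-w4 g2 on the interim LEAD ns-typeII-p2 g10's key (STATUS
2026-08-28T07:47:17Z).  The LEAD's two needle widenings are profile-level and `γ`-general:

* `Loc.curl_eq_zero_of_sphereBarriers` (p611972): a `C²` profile of CIV (3.3) with, for some `κ < γ`, BARRIER SPHERES `⟪y, U y⟫ ≥ −κ‖y‖²` on
  `‖y‖ = R` for radii `R` beyond every bound, is irrotational;
* `Loc.curl_eq_zero_of_piercingIrrotational` (p613616): a `C²` profile of CIV (3.3) such that on spheres `‖y‖ = R` beyond every radius the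
  vorticity VANISHES AT EVERY FAST-INFLOW POINT, `⟪y, U y⟫ ≤ −γ‖y‖² ⇒ curl U y = 0`, is irrotational (⊇ the barrier case, vacuously).

Their member-level forms in the tree are the WHOLE-SLAB CENTRED ones (`Loc.selfSimilar_ae_eq_zero_of_{sphereBarriers,piercingIrrotational}C2_profile`).
This file supplies the PAST-EXACT / SHIFTED forms, by the same wrapper the tree uses for the other tame `C²` past strata
(`…SelfSimilarPastStrata`, p594624): a class member `(u, p, H, c)` (`0 < ρ ≤ ½`) that is exactly self-similar about `(T, x₀)` on a past
sub-slab `τ < T₁` (`T₁ ≤ 0`, `T₁ ≤ T`; arbitrary on `[T₁, 0)`) with a `C²` velocity profile `V` —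

1. profile dictionary: the origin-centred extension from the far past gives a CIV (3.3) profile `(V, P')`
   (`Past.exists_isSelfSimilarEulerProfile`);
2. the profile-level lever gives `curl V ≡ 0`;
3. the irrotational past stratum `Past.selfSimilar_ae_eq_zero_of_irrotationalC2_profile` (profile zero by the far-past `A`-growth ⇒
   quiescent past ⇒ the crux's energy stratum) makes the member vanish on the WHOLE slab.

* `Past.profile_eq_zero_of_piercingIrrotationalC2` / `Past.profile_eq_zero_of_sphereBarriersC2` — profile level (`V = 0`);
* `Past.selfSimilar_ae_eq_zero_of_piercingIrrotationalC2_profile_past` / `Past.selfSimilar_ae_eq_zero_of_sphereBarriersC2_profile_past` —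
  MEMBER LEVEL, crux hypotheses verbatim (`0 < ρ ≤ ½`) + past-exact self-similarity (`IsPastSelfSimilar ρ T T₁ x₀ u p V P` unfolded) +
  `ContDiff ℝ 2 V` + the sphere hypothesis ⇒ `u = 0` a.e. on `(−∞,0) × ℝ³`;
* `Shifted.selfSimilar_ae_eq_zero_of_piercingIrrotationalC2_profile` — the whole-slab shifted case `T₁ = 0 ≤ T` (`IsShiftedSelfSimilar`).

Intended wiring (LEAD's call): widen `IsPastSelfSimilarClassical`'s tame disjunct `IsTameC2Profile ρ V` by `ContDiff ℝ 2 V ∧ HasIrrotationalPiercing ρ V`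
(⊇ `HasBarrierSpheres`, ⊇ the radial-inflow clause).

WHAT THIS IS NOT: not NS, not E — classical sub-strata `--supports` stmt-19832 on the MODEL lattice (19832 is a crux CLASS of E/NS strata, not NS
regularity); the registered needle (a VORTICAL fast-inflow channel through every large sphere), the weak class and the nowhere-self-similar members
stay OPEN. [folklore; ConstantinIgnatovaVicol2026Putative §3.4.1 (3.22)–(3.24), §3.5 (setting)]
-/

noncomputable section

-- flat `Theorems/<Route><Decl>…` files of one crux share the namespace of the crux (tree convention: `Summit.<S>.<S>.…`)
set_option linter.dupNamespace false

open MeasureTheory Set Filter Topology Metric Function InnerProductSpace TopologicalSpace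
open scoped RealInnerProductSpace NNReal ENNReal ContDiff

namespace Summit.NavierStokesRegularity.NavierStokesRegularity.Theorems.PowerGaugeEulerLiouville

open Literature.Analysis Literature.Analysis.FunctionSpaces Literature.Analysis.FluidPDE

namespace Past

variable {ρ T T₁ : ℝ} {x₀ : EuclideanSpace ℝ (Fin 3)}
  {u : ℝ → EuclideanSpace ℝ (Fin 3) → EuclideanSpace ℝ (Fin 3)} {p : ℝ → EuclideanSpace ℝ (Fin 3) → ℝ}
  {H : ℝ → EuclideanSpace ℝ (Fin 3) → EuclideanSpace ℝ (Fin 3) →L[ℝ] EuclideanSpace ℝ (Fin 3)} {c : ℝ≥0}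
  {V : EuclideanSpace ℝ (Fin 3) → EuclideanSpace ℝ (Fin 3)} {P : EuclideanSpace ℝ (Fin 3) → ℝ}

/-! ### Profile level: `V = 0` -/

/-- **Past-exact member, `C²` profile with IRROTATIONAL PIERCING on spheres beyond every radius: the profile is ZERO** (`0 < ρ ≤ ½`): the
extension from the far past supplies a CIV (3.3) profile (`Past.exists_isSelfSimilarEulerProfile`), the LEAD's Lagrangian lever
`Loc.curl_eq_zero_of_piercingIrrotational` (first exit time + Fermat + linear Cauchy equation + null confined vortical set) gives `curl V ≡ 0`, and the
irrotational case `Past.profile_eq_zero_of_irrotationalC2` (far-past `A`-growth) finishes. [folklore] -/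
theorem profile_eq_zero_of_piercingIrrotationalC2 (hρ : 0 < ρ) (hρh : ρ ≤ 1 / 2) (hT₁ : T₁ ≤ 0) (hTT₁ : T₁ ≤ T)
    (hsol : IsDistributionalNSSolutionOn (slab (EuclideanSpace ℝ (Fin 3)) (Iio 0) isOpen_Iio) 0 0 u p)
    (hA : ∀ a : ℝ, 0 < a → ENNReal.ofReal (a ^ (2 * ρ)) *
      cknA a (0 : ℝ × EuclideanSpace ℝ (Fin 3)) u ≤ (c : ℝ≥0∞))
    (hu : ∀ τ : ℝ, τ < T₁ → u τ = fun x => selfSimilarCollapse (1 / (2 + ρ)) T V τ (x - x₀))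
    (hp : ∀ τ : ℝ, τ < T₁ → p τ = fun x => selfSimilarCollapsePressure (1 / (2 + ρ)) T P τ (x - x₀))
    (hV : ContDiff ℝ 2 V)
    (hS : ∀ R₀ : ℝ, ∃ R : ℝ, R₀ ≤ R ∧ ∀ y : EuclideanSpace ℝ (Fin 3), ‖y‖ = R →
      ⟪y, V y⟫ ≤ -(1 / (2 + ρ) * ‖y‖ ^ 2) → curl V y = 0) : V = 0 := by
  -- adapted from `Past.profile_eq_zero_of_radialInflowC2` (…SelfSimilarPastStrata)
  have h2ρ : (0 : ℝ) < 2 + ρ := by linarith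
  have hγ : (0 : ℝ) < 1 / (2 + ρ) := one_div_pos.2 h2ρ
  have hγ2 : 1 / (2 + ρ) < 1 / 2 := one_div_lt_one_div_of_lt two_pos (by linarith)
  obtain ⟨P', hprof⟩ := exists_isSelfSimilarEulerProfile hρ hT₁ hTT₁ hsol hu hp hV
  have hcurl : ∀ x, curl V x = 0 := fun x => Loc.curl_eq_zero_of_piercingIrrotational hprof hγ hγ2 hS x
  exact profile_eq_zero_of_irrotationalC2 hρ hρh hT₁ hTT₁ hsol hA hu hp hV hcurl

/-- **Past-exact member, `C²` profile with BARRIER SPHERES beyond every radius: the profile is ZERO** (`0 < ρ ≤ ½`; some `κ < 1/(2+ρ)` with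
`⟪y, V y⟫ ≥ −κ‖y‖²` on `‖y‖ = R` for radii `R` beyond every bound; the LEAD's `Loc.curl_eq_zero_of_sphereBarriers` on the derived CIV profile, then
the irrotational case).  Widens `Past.profile_eq_zero_of_radialInflowC2` (barrier at EVERY large point). [folklore] -/
theorem profile_eq_zero_of_sphereBarriersC2 (hρ : 0 < ρ) (hρh : ρ ≤ 1 / 2) (hT₁ : T₁ ≤ 0) (hTT₁ : T₁ ≤ T)
    (hsol : IsDistributionalNSSolutionOn (slab (EuclideanSpace ℝ (Fin 3)) (Iio 0) isOpen_Iio) 0 0 u p)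
    (hA : ∀ a : ℝ, 0 < a → ENNReal.ofReal (a ^ (2 * ρ)) *
      cknA a (0 : ℝ × EuclideanSpace ℝ (Fin 3)) u ≤ (c : ℝ≥0∞))
    (hu : ∀ τ : ℝ, τ < T₁ → u τ = fun x => selfSimilarCollapse (1 / (2 + ρ)) T V τ (x - x₀))
    (hp : ∀ τ : ℝ, τ < T₁ → p τ = fun x => selfSimilarCollapsePressure (1 / (2 + ρ)) T P τ (x - x₀))
    (hV : ContDiff ℝ 2 V) {κ : ℝ} (hκ : κ < 1 / (2 + ρ))
    (hS : ∀ R₀ : ℝ, ∃ R : ℝ, R₀ ≤ R ∧ ∀ y : EuclideanSpace ℝ (Fin 3), ‖y‖ = R → -(κ * ‖y‖ ^ 2) ≤ ⟪y, V y⟫) :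
    V = 0 := by
  -- adapted from `Past.profile_eq_zero_of_radialInflowC2` (…SelfSimilarPastStrata)
  have h2ρ : (0 : ℝ) < 2 + ρ := by linarith
  have hγ : (0 : ℝ) < 1 / (2 + ρ) := one_div_pos.2 h2ρ
  have hγ2 : 1 / (2 + ρ) < 1 / 2 := one_div_lt_one_div_of_lt two_pos (by linarith)
  obtain ⟨P', hprof⟩ := exists_isSelfSimilarEulerProfile hρ hT₁ hTT₁ hsol hu hp hV
  have hcurl : ∀ x, curl V x = 0 := fun x => Loc.curl_eq_zero_of_sphereBarriers hprof hκ hS hγ hγ2 x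
  exact profile_eq_zero_of_irrotationalC2 hρ hρh hT₁ hTT₁ hsol hA hu hp hV hcurl

/-! ### Member level: crux hypotheses verbatim -/

/-- **PAST-EXACT MEMBER WHOSE `C²` PROFILE HAS IRROTATIONAL PIERCING BEYOND EVERY RADIUS IS TRIVIAL** (crux hypotheses verbatim, `0 < ρ ≤ ½`,
exact self-similarity about `(T, x₀)` for `τ < T₁`, `T₁ ≤ 0`, `T₁ ≤ T`; `V ∈ C²`; radii `R` beyond every bound with
`⟪y, V y⟫ ≤ −‖y‖²/(2+ρ) ⇒ curl V y = 0` on `‖y‖ = R`).  The past twin of `Loc.selfSimilar_ae_eq_zero_of_piercingIrrotationalC2_profile`; binder shape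
`IsPastSelfSimilar ρ T T₁ x₀ u p V P` + `ContDiff ℝ 2 V` + `HasIrrotationalPiercing ρ V` of the lead skeleton. [folklore] -/
theorem selfSimilar_ae_eq_zero_of_piercingIrrotationalC2_profile_past (hρ : 0 < ρ) (hρh : ρ ≤ 1 / 2) (hT₁ : T₁ ≤ 0)
    (hTT₁ : T₁ ≤ T) (x₀ : EuclideanSpace ℝ (Fin 3))
    (hsw : IsSuitableWeakSolutionOn (slab (EuclideanSpace ℝ (Fin 3)) (Iio 0) isOpen_Iio) 0 0 u p)
    (hH : HasWeakSpatialGradientOn (slab (EuclideanSpace ℝ (Fin 3)) (Iio 0) isOpen_Iio) u H)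
    (hgauge : ∀ a : ℝ, 0 < a →
      ENNReal.ofReal (a ^ (2 * ρ)) * cknA a (0 : ℝ × EuclideanSpace ℝ (Fin 3)) u +
          ENNReal.ofReal (a ^ ρ) * cknE a (0 : ℝ × EuclideanSpace ℝ (Fin 3)) H +
        ENNReal.ofReal (a ^ (2 * ρ)) * cknD a (0 : ℝ × EuclideanSpace ℝ (Fin 3)) p ≤ (c : ℝ≥0∞))
    (hu : ∀ τ : ℝ, τ < T₁ → u τ = fun x => selfSimilarCollapse (1 / (2 + ρ)) T V τ (x - x₀))
    (hp : ∀ τ : ℝ, τ < T₁ → p τ = fun x => selfSimilarCollapsePressure (1 / (2 + ρ)) T P τ (x - x₀))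
    (hV : ContDiff ℝ 2 V)
    (hS : ∀ R₀ : ℝ, ∃ R : ℝ, R₀ ≤ R ∧ ∀ y : EuclideanSpace ℝ (Fin 3), ‖y‖ = R →
      ⟪y, V y⟫ ≤ -(1 / (2 + ρ) * ‖y‖ ^ 2) → curl V y = 0) :
    uncurry u =ᵐ[volume.restrict (Iio (0 : ℝ) ×ˢ (univ : Set (EuclideanSpace ℝ (Fin 3))))] 0 :=
  have hA : ∀ a : ℝ, 0 < a → ENNReal.ofReal (a ^ (2 * ρ)) *
      cknA a (0 : ℝ × EuclideanSpace ℝ (Fin 3)) u ≤ (c : ℝ≥0∞) :=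
    fun a ha => le_trans (le_trans le_self_add le_self_add) (hgauge a ha)
  ae_eq_zero_of_profile_eq_zero hρ.le hsw hH hgauge hu
    (profile_eq_zero_of_piercingIrrotationalC2 hρ hρh hT₁ hTT₁ hsw.distributional hA hu hp hV hS)

/-- **PAST-EXACT MEMBER WHOSE `C²` PROFILE HAS BARRIER SPHERES BEYOND EVERY RADIUS IS TRIVIAL** (crux hypotheses verbatim, `0 < ρ ≤ ½`, exact
self-similarity about `(T, x₀)` for `τ < T₁`, `T₁ ≤ 0`, `T₁ ≤ T`; `V ∈ C²`; some `κ < 1/(2+ρ)` with `⟪y, V y⟫ ≥ −κ‖y‖²` on spheres `‖y‖ = R` beyond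
every radius).  The past twin of `Loc.selfSimilar_ae_eq_zero_of_sphereBarriersC2_profile`; binder shape `IsPastSelfSimilar` + `ContDiff ℝ 2 V` +
`HasBarrierSpheres ρ V`; widens `Past.selfSimilar_ae_eq_zero_of_radialInflowC2_profile`. [folklore] -/
theorem selfSimilar_ae_eq_zero_of_sphereBarriersC2_profile_past (hρ : 0 < ρ) (hρh : ρ ≤ 1 / 2) (hT₁ : T₁ ≤ 0) (hTT₁ : T₁ ≤ T)
    (x₀ : EuclideanSpace ℝ (Fin 3))
    (hsw : IsSuitableWeakSolutionOn (slab (EuclideanSpace ℝ (Fin 3)) (Iio 0) isOpen_Iio) 0 0 u p)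
    (hH : HasWeakSpatialGradientOn (slab (EuclideanSpace ℝ (Fin 3)) (Iio 0) isOpen_Iio) u H)
    (hgauge : ∀ a : ℝ, 0 < a →
      ENNReal.ofReal (a ^ (2 * ρ)) * cknA a (0 : ℝ × EuclideanSpace ℝ (Fin 3)) u +
          ENNReal.ofReal (a ^ ρ) * cknE a (0 : ℝ × EuclideanSpace ℝ (Fin 3)) H +
        ENNReal.ofReal (a ^ (2 * ρ)) * cknD a (0 : ℝ × EuclideanSpace ℝ (Fin 3)) p ≤ (c : ℝ≥0∞))
    (hu : ∀ τ : ℝ, τ < T₁ → u τ = fun x => selfSimilarCollapse (1 / (2 + ρ)) T V τ (x - x₀))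
    (hp : ∀ τ : ℝ, τ < T₁ → p τ = fun x => selfSimilarCollapsePressure (1 / (2 + ρ)) T P τ (x - x₀))
    (hV : ContDiff ℝ 2 V) {κ : ℝ} (hκ : κ < 1 / (2 + ρ))
    (hS : ∀ R₀ : ℝ, ∃ R : ℝ, R₀ ≤ R ∧ ∀ y : EuclideanSpace ℝ (Fin 3), ‖y‖ = R → -(κ * ‖y‖ ^ 2) ≤ ⟪y, V y⟫) :
    uncurry u =ᵐ[volume.restrict (Iio (0 : ℝ) ×ˢ (univ : Set (EuclideanSpace ℝ (Fin 3))))] 0 :=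
  have hA : ∀ a : ℝ, 0 < a → ENNReal.ofReal (a ^ (2 * ρ)) *
      cknA a (0 : ℝ × EuclideanSpace ℝ (Fin 3)) u ≤ (c : ℝ≥0∞) :=
    fun a ha => le_trans (le_trans le_self_add le_self_add) (hgauge a ha)
  ae_eq_zero_of_profile_eq_zero hρ.le hsw hH hgauge hu
    (profile_eq_zero_of_sphereBarriersC2 hρ hρh hT₁ hTT₁ hsw.distributional hA hu hp hV hκ hS)

end Past

namespace Shifted

variable {ρ T : ℝ}
  {u : ℝ → EuclideanSpace ℝ (Fin 3) → EuclideanSpace ℝ (Fin 3)} {p : ℝ → EuclideanSpace ℝ (Fin 3) → ℝ}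
  {H : ℝ → EuclideanSpace ℝ (Fin 3) → EuclideanSpace ℝ (Fin 3) →L[ℝ] EuclideanSpace ℝ (Fin 3)} {c : ℝ≥0}
  {V : EuclideanSpace ℝ (Fin 3) → EuclideanSpace ℝ (Fin 3)} {P : EuclideanSpace ℝ (Fin 3) → ℝ}

/-- **SHIFTED MEMBER (whole slab, blow-up point `(T, x₀)`, `T ≥ 0`) WHOSE `C²` PROFILE HAS IRROTATIONAL PIERCING BEYOND EVERY RADIUS IS TRIVIAL**
(crux hypotheses verbatim, `0 < ρ ≤ ½`; binder shape `IsShiftedSelfSimilar ρ T x₀ u p V P` + `ContDiff ℝ 2 V` + `HasIrrotationalPiercing ρ V`):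
the case `T₁ = 0` of `Past.selfSimilar_ae_eq_zero_of_piercingIrrotationalC2_profile_past`. [folklore] -/
theorem selfSimilar_ae_eq_zero_of_piercingIrrotationalC2_profile (hρ : 0 < ρ) (hρh : ρ ≤ 1 / 2) (hT : 0 ≤ T)
    (x₀ : EuclideanSpace ℝ (Fin 3))
    (hsw : IsSuitableWeakSolutionOn (slab (EuclideanSpace ℝ (Fin 3)) (Iio 0) isOpen_Iio) 0 0 u p)
    (hH : HasWeakSpatialGradientOn (slab (EuclideanSpace ℝ (Fin 3)) (Iio 0) isOpen_Iio) u H)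
    (hgauge : ∀ a : ℝ, 0 < a →
      ENNReal.ofReal (a ^ (2 * ρ)) * cknA a (0 : ℝ × EuclideanSpace ℝ (Fin 3)) u +
          ENNReal.ofReal (a ^ ρ) * cknE a (0 : ℝ × EuclideanSpace ℝ (Fin 3)) H +
        ENNReal.ofReal (a ^ (2 * ρ)) * cknD a (0 : ℝ × EuclideanSpace ℝ (Fin 3)) p ≤ (c : ℝ≥0∞))
    (hu : ∀ τ : ℝ, τ < 0 → u τ = fun x => selfSimilarCollapse (1 / (2 + ρ)) T V τ (x - x₀))
    (hp : ∀ τ : ℝ, τ < 0 → p τ = fun x => selfSimilarCollapsePressure (1 / (2 + ρ)) T P τ (x - x₀))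
    (hV : ContDiff ℝ 2 V)
    (hS : ∀ R₀ : ℝ, ∃ R : ℝ, R₀ ≤ R ∧ ∀ y : EuclideanSpace ℝ (Fin 3), ‖y‖ = R →
      ⟪y, V y⟫ ≤ -(1 / (2 + ρ) * ‖y‖ ^ 2) → curl V y = 0) :
    uncurry u =ᵐ[volume.restrict (Iio (0 : ℝ) ×ˢ (univ : Set (EuclideanSpace ℝ (Fin 3))))] 0 :=
  Past.selfSimilar_ae_eq_zero_of_piercingIrrotationalC2_profile_past (T₁ := 0) hρ hρh le_rfl hT x₀ hsw hH hgauge hu hp hV hS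

end Shifted

end Summit.NavierStokesRegularity.NavierStokesRegularity.Theorems.PowerGaugeEulerLiouville

end
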